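import Mathlib.RepresentationTheory.Homological.GroupCohomology.Functoriality
import Literature.AlgebraicGeometry.HodgeTheory.LocallyTrivialExtensionClasses

/-!
# Route LinearSystemTorelli — crux `LocalTubeSpan` (stmt-HodgeConjecture-2490): the layer lemmas

Helper file (`--supports stmt-HodgeConjecture-2490`, line `Sketch` of the crux chain, stub
`stub_layers`). The crux ("local Schnell theorem": at a point `s₀` of the discriminant, Schnell's
third map `H¹(G_{s₀}, V) → ∏_{g ∈ G_{s₀}} V/(g - 1)V` loses nothing on the classes coming from
primitive cohomology; [Schnell2010] §3 (the third map), §7) is unscrewed by card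
`johnson-flux-detection` along a tower `K ⊲ G ↠ Γ = G/K` of the local group (the Hochschild–Serre
layers of `H¹`). Over the tree's vocabulary
(`Literature.AlgebraicGeometry.HodgeTheory.LocallyTrivialExtensionClasses`: the restriction kernel
`H1resKer A K = ker (res : H¹(G, A) → H¹(K, A))`, Schnell's third map on a subgroup
`evalCoinvOn A K : H¹(G, A) → ∏_{g ∈ K} A/(g - 1)A`, `subOneRange A g = (g - 1)A`) this file proves
the card's three layer lemmas, for an arbitrary commutative ring `k`, group `G`, representation `A`
and subgroup `K ≤ G`:

* `localTubeSpan_evalCoinvOn_eq_zero_imp_of_layers` — the LAYER LEMMA (pure lattice logic): if a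
  subspace `𝒲 ⊆ H¹(G, A)` meets the restriction kernel of `K` trivially (`𝒲 ⊓ ker res_K = ⊥`: no
  class of `𝒲` is inflated from `G/K`) and every class of `𝒲` undetected on `K` restricts to zero
  on `K`, then every class of `𝒲` undetected on `K` is zero.
* `localTubeSpan_mem_H1resKer_of_trivial_action` — on a subgroup `K` acting trivially, "undetected
  on `K`" (`evalCoinvOn A K ξ = 0`, i.e. `φ g ∈ (g - 1)A = 0` for `g ∈ K`) already forces
  "restricts to zero on `K`" (the cocycle vanishes on `K`; [Schnell2010] §7, first paragraph of the
  proof of Prop. 12).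
* `localTubeSpan_eq_zero_of_trivial_layer` — the two combined: for `K` acting trivially and
  `𝒲 ⊓ ker res_K = ⊥`, the classes of `𝒲` undetected on `K` vanish.

No named facts, no geometry. Reference: C. Schnell, *Primitive cohomology and the tube mapping*,
Math. Z. 268 (2010) 1069–1089 (= arXiv:0711.3927), §3 (the three maps, eq. (restr-M)), §7 (proof of
Prop. 12).
-/

-- `Summit.HodgeConjecture.HodgeConjecture.Theorems` is the mandated namespace (single-conjunct summit:
-- Sub = Summit), which `linter.dupNamespace` flags on every declaration; the lakefile turns the
-- linter off tree-wide (weak option), restated here so stand-alone elaboration is warning-free too.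
set_option linter.dupNamespace false

noncomputable section

open CategoryTheory groupCohomology
open Literature.AlgebraicGeometry.HodgeTheory

namespace Summit.HodgeConjecture.HodgeConjecture.Theorems

universe u

/-- **Layer lemma** (card `johnson-flux-detection`, the Hochschild–Serre unscrewing of `H¹` of the
local group along `K ⊲ G ↠ G/K`). If a subspace `𝒲 ⊆ H¹(G, A)` meets the restriction kernel of `K`
trivially (`𝒲 ⊓ ker res_K = ⊥`: no non-zero class of `𝒲` is inflated from `G/K`) and every class of
`𝒲` undetected by Schnell's third map on `K` restricts to zero on `K`, then every class of `𝒲`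
undetected on `K` is zero: such a class lies in `𝒲 ⊓ ker res_K = ⊥`.
[cite: Schnell2010, §7 (proof of Prop. 12)] -/
theorem localTubeSpan_evalCoinvOn_eq_zero_imp_of_layers {k G : Type u} [CommRing k] [Group G]
    (A : Rep k G) (K : Subgroup G) (𝒲 : Submodule k (groupCohomology.H1 A))
    (hLevi : 𝒲 ⊓ H1resKer A K = ⊥)
    (hUnip : ∀ ξ ∈ 𝒲, evalCoinvOn A K ξ = 0 → ξ ∈ H1resKer A K) :
    ∀ ξ ∈ 𝒲, evalCoinvOn A K ξ = 0 → ξ = 0 := by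
  intro ξ hξ h0
  have hmem : ξ ∈ 𝒲 ⊓ H1resKer A K := Submodule.mem_inf.2 ⟨hξ, hUnip ξ hξ h0⟩
  rw [hLevi] at hmem
  exact (Submodule.mem_bot k).1 hmem

/-- **Trivial layer.** On a subgroup `K ≤ G` acting trivially on `A`, a class undetected by
Schnell's third map on `K` (`evalCoinvOn A K ξ = 0`: for a representing cocycle `φ`,
`φ g ∈ (g - 1)A` for all `g ∈ K`) restricts to zero on `K`: for `g ∈ K` one has `(g - 1)A = 0`,
so `φ` vanishes on `K` and `φ|_K` is the coboundary of `x = 0`.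
[cite: Schnell2010, §7 (proof of Prop. 12, first paragraph)] -/
theorem localTubeSpan_mem_H1resKer_of_trivial_action {k G : Type u} [CommRing k] [Group G]
    (A : Rep k G) (K : Subgroup G) (hK : ∀ g ∈ K, ∀ v : A.V, A.ρ g v = v)
    {ξ : groupCohomology.H1 A} (hξ : evalCoinvOn A K ξ = 0) : ξ ∈ H1resKer A K := by
  induction ξ using H1_induction_on with
  | h φ =>
    refine (H1resKer_mk_iff K φ).2 ⟨0, fun g hg => ?_⟩
    have h : (φ : G → A.V) g ∈ subOneRange A g := by
      have h' := congr_fun hξ ⟨g, hg⟩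
      rwa [evalCoinvOn_H1π, Pi.zero_apply, Submodule.mkQ_apply,
        Submodule.Quotient.mk_eq_zero] at h'
    obtain ⟨v, hv⟩ := h
    rw [map_zero, sub_zero, ← hv, LinearMap.sub_apply, LinearMap.id_apply, hK g hg v, sub_self]

/-- **Trivial layer, concluded.** For a subgroup `K ≤ G` acting trivially on `A` and a subspace
`𝒲 ⊆ H¹(G, A)` meeting the restriction kernel of `K` trivially (`𝒲 ⊓ ker res_K = ⊥`), every class
of `𝒲` undetected by Schnell's third map on `K` is zero
(`localTubeSpan_mem_H1resKer_of_trivial_action` + `localTubeSpan_evalCoinvOn_eq_zero_imp_of_layers`).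
[cite: Schnell2010, §7 (proof of Prop. 12)] -/
theorem localTubeSpan_eq_zero_of_trivial_layer {k G : Type u} [CommRing k] [Group G]
    (A : Rep k G) (K : Subgroup G) (hK : ∀ g ∈ K, ∀ v : A.V, A.ρ g v = v)
    (𝒲 : Submodule k (groupCohomology.H1 A)) (hLevi : 𝒲 ⊓ H1resKer A K = ⊥) :
    ∀ ξ ∈ 𝒲, evalCoinvOn A K ξ = 0 → ξ = 0 :=
  localTubeSpan_evalCoinvOn_eq_zero_imp_of_layers A K 𝒲 hLevi fun _ _ h0 =>
    localTubeSpan_mem_H1resKer_of_trivial_action A K hK h0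

end Summit.HodgeConjecture.HodgeConjecture.Theorems

end
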